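import Literature.MathematicalPhysics.QuantumFieldTheory.Balaban1983to89.B9Thm314Whole

/-!
# `Balaban1983to89.B9Thm314WholeParts` — [B9] Theorem 3.14 (pp. 426–427): the local leaf `B9Thm314.Thm314LocalPrinted` FROM ITS THREE
# PARTS (sup, L², Hölder entries with the additional factor on y, y′ ∈ Ω^{(k)}), and back — companion of `B9Thm314Whole`

T. Bałaban, *Propagators for lattice gauge theories in a background field*, Commun. Math. Phys. **99** (1985) 389–434
[`Balaban1985BackgroundPropagators`, "B9"], Theorem 3.14 pp. 426–427: *"their difference satisfies all the inequalities characteristic for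
operators of the considered type, with the additional factor exp(−δ₀d(y, y′, Ω))"* — the «characteristic inequalities» of an operator of type
G′/G are the three local blocks (3.42) (sup), (3.46) (L²), (3.43)–(3.45) (Hölder) of Theorem 3.1 (pp. 397–398).

statement-level skeleton of published theorems with citation tags; proofs where landed; nothing here is a claim about the Yang–Mills mass gap

WHY.  The two landed ROUTES to Theorem 3.14 reach the local leaf's parts separately: the RESOLVENT route (`B9Thm314ResolventCore` …
`B9Thm314SupReading.thm314SupOn_of_hasMajorantHom`, seat n06-a) gives the sup part `B9Thm314.Thm314SupOn` with M-UNIFORM constants of its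
inputs; the RANDOM-WALK route (`B9Thm314Whole.thm314LocalPrinted_of_leaves`, the printed proof) gives all three parts but M-uniformly only
under the displayed diameter bound (typed-leaf flag T314 part (ii)).  This companion lets a pin COMBINE parts from either route:
`Thm314L2On`, `Thm314HolderOn` (the L² and Hölder parts as family statements in the quantifier template of `Thm314SupOn`),
`parts_of_thm314LocalPrinted` (projections) and ★ `thm314LocalPrinted_of_parts` (assembly: thresholds merged by max/min, ONE rate for all
parts and both exponentials — *"after adjusting a definition of δ₀"* — constants by max, Hölder constants cut below at 0; needs d ≥ 0,
d(·,·,Ω) ≥ 0 and the model signs).  Kernel-checked bookkeeping; nothing of print asserted; count-neutral; NOT a node discharge; nothing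
continuum, nothing about the mass gap.  Cell `pub-ymgap` (HUMAN RULING D-0062), node N06 [B9], N06-ASSIGNMENT v1 rows 22–23, seat
`pub-ymgap-dag-n06-m`, 2026-08-26.
-/

namespace Literature.MathematicalPhysics.QuantumFieldTheory.Balaban1983to89.B9Thm314WholeParts

open B9 B9Thm314 B9Thm314Whole B9FromB6ModelSignsOn

/-! ## The three parts of the local leaf; projections; assembly -/

section Parts

variable {I : Type}

/-- The L² part of Theorem 3.14's local reading: the six entries (3.46) with the additional factor on the restriction `OmK`, M-uniform
constants. [cite: Balaban1985BackgroundPropagators, Thm 3.14 pp.426–427 + (3.46) p.398] -/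
def Thm314L2On (c35 : ℝ) (geo : I → Geometry) (bg : I → Backgrounds) (Kdiff : ∀ i, KernelFamily (geo i) (bg i))
    (OmK : ∀ i, (geo i).Site → Prop) (dOmega : ∀ i, (geo i).Site → (geo i).Site → ℝ) : Prop :=
  ∃ M₅ δ₀ a₀ B₀ : ℝ, 0 < M₅ ∧ 0 < δ₀ ∧ 0 < a₀ ∧ 0 < B₀ ∧
    ∀ i : I, M₅ ≤ (geo i).M → ∀ α₀ : ℝ, 0 < α₀ → (geo i).M * α₀ ≤ a₀ →
      ∀ U : (bg i).Cfg, (bg i).Reg335 c35 α₀ U →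
        IneqL2F (Kdiff i) B₀ δ₀ (OmK i) (fun y y' => Real.exp (-(δ₀ * dOmega i y y'))) U

/-- The Hölder part of Theorem 3.14's local reading: (3.43)–(3.45) with the additional factor on `OmK`, constants B₀(β), B′₀(ε), B′₀(ε,β)
and thresholds BEFORE the member. [cite: Balaban1985BackgroundPropagators, Thm 3.14 pp.426–427 + (3.43)–(3.45) p.398] -/
def Thm314HolderOn (c35 : ℝ) (geo : I → Geometry) (bg : I → Backgrounds) (Kdiff : ∀ i, KernelFamily (geo i) (bg i))
    (OmK : ∀ i, (geo i).Site → Prop) (dOmega : ∀ i, (geo i).Site → (geo i).Site → ℝ) : Prop :=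
  ∃ M₅ δ₀ a₀ : ℝ, ∃ Bβ Bε : ℝ → ℝ, ∃ Bεβ : ℝ → ℝ → ℝ, 0 < M₅ ∧ 0 < δ₀ ∧ 0 < a₀ ∧
    ∀ i : I, M₅ ≤ (geo i).M → ∀ α₀ : ℝ, 0 < α₀ → (geo i).M * α₀ ≤ a₀ →
      ∀ U : (bg i).Cfg, (bg i).Reg335 c35 α₀ U →
        IneqHolderF (Kdiff i) Bβ Bε Bεβ δ₀ (OmK i) (fun y y' => Real.exp (-(δ₀ * dOmega i y y'))) U

variable {c35 : ℝ} {geo : I → Geometry} {bg : I → Backgrounds} {Kdiff : ∀ i, KernelFamily (geo i) (bg i)}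
  {OmK : ∀ i, (geo i).Site → Prop} {dOmega : ∀ i, (geo i).Site → (geo i).Site → ℝ} {Ps : ∀ i, (geo i).Loc → Prop}

/-- **The local leaf IS its three parts** (projections): `B9Thm314.Thm314SupOn` (n06-a's `supOn_of_local`), `Thm314L2On`, `Thm314HolderOn`.
[cite: Balaban1985BackgroundPropagators, Thm 3.14 pp.426–427 (bookkeeping)] -/
theorem parts_of_thm314LocalPrinted (h : Thm314LocalPrinted c35 geo bg Kdiff OmK dOmega) :
    Thm314SupOn c35 geo bg Kdiff OmK dOmega ∧ Thm314L2On c35 geo bg Kdiff OmK dOmega ∧ Thm314HolderOn c35 geo bg Kdiff OmK dOmega := by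
  refine ⟨supOn_of_local h, ?_, ?_⟩
  · obtain ⟨M₅, δ₀, a₀, B₀, Bβ, Bε, Bεβ, hM, hδ, ha, hB, H⟩ := h
    exact ⟨M₅, δ₀, a₀, B₀, hM, hδ, ha, hB, fun i hMi α₀ hα hMa U hU => (H i hMi α₀ hα hMa U hU).2.1⟩
  · obtain ⟨M₅, δ₀, a₀, B₀, Bβ, Bε, Bεβ, hM, hδ, ha, -, H⟩ := h
    exact ⟨M₅, δ₀, a₀, Bβ, Bε, Bεβ, hM, hδ, ha, fun i hMi α₀ hα hMa U hU => (H i hMi α₀ hα hMa U hU).2.2⟩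

/-- ★ **ASSEMBLY OF THE LOCAL LEAF FROM ITS THREE PARTS, from any routes** (e.g. the sup part M-uniformly from the resolvent route
`B9Thm314SupReading.thm314SupOn_of_hasMajorantHom`, the L² and Hölder parts from §3 or from block-norm sums): thresholds by `max`/`min`,
ONE rate δ = min(δ₁, δ₂, δ₃) for all three parts and both exponentials («after adjusting a definition of δ₀»; needs d ≥ 0, d(·,·,Ω) ≥ 0 and
the model signs), constants B₀ = max(B₀¹, B₀²), Hölder constants cut below at 0. [cite: Balaban1985BackgroundPropagators, Thm 3.14 (3.154) pp.426–427] -/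
theorem thm314LocalPrinted_of_parts (S : ∀ i, ModelSignsOn (geo i) (Ps i)) (hdΩ : ∀ (i : I) (y y' : (geo i).Site), 0 ≤ dOmega i y y')
    (h₁ : Thm314SupOn c35 geo bg Kdiff OmK dOmega) (h₂ : Thm314L2On c35 geo bg Kdiff OmK dOmega)
    (h₃ : Thm314HolderOn c35 geo bg Kdiff OmK dOmega) : Thm314LocalPrinted c35 geo bg Kdiff OmK dOmega := by
  obtain ⟨M₁, δ₁, a₁, B₁, hM₁, hδ₁, ha₁, hB₁, H₁⟩ := h₁
  obtain ⟨M₂, δ₂, a₂, B₂, hM₂, hδ₂, ha₂, hB₂, H₂⟩ := h₂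
  obtain ⟨M₃, δ₃, a₃, Bβ, Bε, Bεβ, hM₃, hδ₃, ha₃, H₃⟩ := h₃
  set δ := min δ₁ (min δ₂ δ₃) with hδdef
  have hδ1 : δ ≤ δ₁ := min_le_left _ _
  have hδ2 : δ ≤ δ₂ := le_trans (min_le_right _ _) (min_le_left _ _)
  have hδ3 : δ ≤ δ₃ := le_trans (min_le_right _ _) (min_le_right _ _)
  refine ⟨max M₁ (max M₂ M₃), δ, min a₁ (min a₂ a₃), max B₁ B₂, fun β => max (Bβ β) 0, fun ε => max (Bε ε) 0,
    fun ε β => max (Bεβ ε β) 0, lt_max_of_lt_left hM₁, lt_min hδ₁ (lt_min hδ₂ hδ₃), lt_min ha₁ (lt_min ha₂ ha₃),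
    lt_max_of_lt_left hB₁, fun i hMi α₀ hα hMa U hU => ?_⟩
  have Fle : ∀ {a : ℝ}, δ ≤ a → ∀ y y' : (geo i).Site, Real.exp (-(a * dOmega i y y')) ≤ Real.exp (-(δ * dOmega i y y')) :=
    fun ha y y' => Real.exp_le_exp.2 (neg_le_neg (mul_le_mul_of_nonneg_right ha (hdΩ i y y')))
  have F0 : ∀ (a : ℝ) (y y' : (geo i).Site), 0 ≤ Real.exp (-(a * dOmega i y y')) := fun _ _ _ => (Real.exp_pos _).le
  have hB0 : 0 ≤ max B₁ B₂ := le_trans hB₁.le (le_max_left _ _)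
  refine ⟨?_, ?_, ?_⟩
  · exact ineqSupF_weaken (S i) (H₁ i (le_trans (le_max_left _ _) hMi) α₀ hα (le_trans hMa (min_le_left _ _)) U hU)
      (le_max_left _ _) hB0 hδ1 (Fle hδ1) (F0 δ₁)
  · exact ineqL2F_weaken (S i) (H₂ i (le_trans (le_trans (le_max_left _ _) (le_max_right _ _)) hMi) α₀ hα
      (le_trans hMa (le_trans (min_le_right _ _) (min_le_left _ _))) U hU) (le_max_right _ _) hB0 hδ2 (Fle hδ2) (F0 δ₂)
  · exact ineqHolderF_weaken (S i) (H₃ i (le_trans (le_trans (le_max_right _ _) (le_max_right _ _)) hMi) α₀ hα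
      (le_trans hMa (le_trans (min_le_right _ _) (min_le_right _ _))) U hU) (fun β => le_max_left _ _) (fun β => le_max_right _ _)
      (fun ε => le_max_left _ _) (fun ε => le_max_right _ _) (fun ε β => le_max_left _ _) (fun ε β => le_max_right _ _) hδ3
      (Fle hδ3) (F0 δ₃)

end Parts

end Literature.MathematicalPhysics.QuantumFieldTheory.Balaban1983to89.B9Thm314WholeParts
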